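import Summits.HodgeConjecture.HodgeConjecture.Theorems.EndoscopicMiddleDegreeOrthogonalSplit
import Summits.HodgeConjecture.HodgeConjecture.Theorems.MiddleThetaSpan.Negative.TwoSummands

/-!
# Route EndoscopicMiddleDegree · `EnvelopedOfThetaSpan` (stmt-HodgeConjecture-14732) — the theta span
kills the theta-orthogonal kernel, and the zero class is enveloped by the zero correspondence

`EnvelopedOfThetaSpan := MiddleThetaSpan → OrthogonalEnveloped`. PROOF. Fix `μ`, `m`, `X`,
`D : UnitaryBallQuotientDatum (2(m+1)) X` and a rational Hodge `(n,n)`-class `e` (`n = m + 1`) with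
`e ∪ x = 0` for all `x` in the theta world `TW(D) = SCⁿ(D) ⊔ SCon(D) ⊔ Hdg^{m,m}_ℚ · N¹`.
(1) The theta span `M(D) = SCⁿ(D) ⊔ SC^m(D) · N¹ ⊔ Hdg^{m,m}_ℚ · N¹` lies in `ker (e ∪ ·)`: summands 1 and
3 are summands of `TW(D)`; summand 2 lies in summand 3 (`spanCup_sc_le_spanCup_ratHodge`: `SC^m` is the
complex span of its rational classes, which are of type `(m,m)` — supported in codimension `≥ m`,
Grothendieck's coniveau inclusion `Grothendieck1969_supportedClasses_le_hodgeConiveau`).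
(2) `MiddleThetaSpan` puts EVERY rational Hodge `(n,n)`-class in `M(D)`, so `e` is cup-orthogonal to all
of them; by the perfect pairing on Hodge classes (BFNP 2009 (6.1), the named fact
`hodgeClasses_cupPairing_nondegenerate (2n) X`, middle case) `e = 0` —
`eq_zero_of_thetaSpan_of_cup_orthogonal`.
(3) The zero class is enveloped by the zero correspondence `γ = 0 ∈ algebraicClasses (X ⊗ X) n`: its
action `P β = pr₁₊(pr₂* β ∪ 0) = 0` preserves rational classes (`IsRationalClass.zero`), has `(n,n)` image
(`IsOfHodgeType.zero` in the Hodge model carried by `e`), and fixes `0` — `orthogonalEnveloped_zero`,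
unconditional.
CONDITIONAL (gate: `conditional-result`): `envelopedOfThetaSpan_of_cupPairing` on the two Literature
named facts `Grothendieck1969_supportedClasses_le_hodgeConiveau` and `hodgeClasses_cupPairing_nondegenerate`;
the corollary `envelopedOfThetaSpan_of_kaehlerPackage` trades the latter for the Kähler package
`hardLefschetz_hodgeRiemann` of `orthogonalSplit_of_kaehlerPackage` (hard Lefschetz + Hodge–Riemann ⟹ (6.1),
the tree theorem `hodgeClasses_cupPairing_nondegenerate_of_hardLefschetz_hodgeRiemann` with
`hodgePQ_independent_of_hodgeModel_holds`), so the route's residue does not grow. Not here: any use of the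
conclusion — `MiddleThetaSpan` is conditionally false at `m = 1`
(`MiddleThetaSpan_false_of_epsNegativeCapWitness`); this glue records the dichotomy "theta spans ⟹ the
kernel `E(D)` is zero ⟹ the envelope is vacuous" and nothing more.
-/

noncomputable section

-- `Summit.HodgeConjecture.HodgeConjecture.Theorems` is the mandated namespace (single-problem summit),
-- flagged by `linter.dupNamespace`; off tree-wide in the lakefile, restated for stand-alone elaboration.
set_option linter.dupNamespace false

open Literature.AlgebraicGeometry.Motives Literature.AlgebraicGeometry.HodgeTheory
open Literature.AlgebraicGeometry.ShimuraVarieties Literature.AlgebraicTopology.SingularHomology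
open CategoryTheory

namespace Summit.HodgeConjecture.HodgeConjecture.Theorems

open MiddleThetaSpan.Negative.TwoSummands (spanCup_sc_le_spanCup_ratHodge)

variable {m : ℕ} {X : SchemeOver ℂ}

/-- **The zero class is enveloped by the zero correspondence** (unconditional). For an orientation
family `μ`, a datum `D : UnitaryBallQuotientDatum (2(m+1)) X` and a Hodge model `A` of `X`: the class
`γ = 0 ∈ algebraicClasses (X ⊗ X) (m+1)` acts by `P β = pr₁₊(pr₂* β ∪ 0) = 0` (`pr₁₊ = complexGysin μ` and
the cup product are linear), which preserves rational classes (`IsRationalClass.zero`), has image of type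
`(m+1,m+1)` (`IsOfHodgeType.zero` in `A`), and fixes `0`. This is the conclusion of `OrthogonalEnveloped`
at `e = 0`, verbatim. [cite: VoisinHodgeI2002, §7.1.1 and §7.3.2] -/
theorem orthogonalEnveloped_zero (μ : OrientationFamily) (D : UnitaryBallQuotientDatum (2 * (m + 1)) X)
    (A : HodgeModel (2 * (m + 1)) X) :
    ∃ γ ∈ algebraicClasses (MonoidalCategoryStruct.tensorObj X X) (2 * (m + 1)),
      let P : complexBetti X (2 * (m + 1)) → complexBetti X (2 * (m + 1)) := fun β =>
        complexGysin μ (IsSmoothProjective.tensor_holds D.isSmoothProjective D.isSmoothProjective)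
          D.isSmoothProjective (CartesianMonoidalCategory.fst X X)
          (show 2 * (m + 1) + 2 * (2 * (m + 1)) + 2 * (2 * (m + 1)) =
            2 * (m + 1) + 2 * (2 * (m + 1) + 2 * (m + 1)) by ring)
          (cupProduct (rfl : 2 * (m + 1) + 2 * (2 * (m + 1)) = 2 * (m + 1) + 2 * (2 * (m + 1)))
            (complexBetti.map (CartesianMonoidalCategory.snd X X) (2 * (m + 1)) β) γ);
      (∀ β, IsRationalClass β → IsRationalClass (P β)) ∧
        (∀ β, IsOfHodgeType (2 * (m + 1)) X (2 * (m + 1)) (m + 1) (m + 1) (P β)) ∧ P 0 = 0 := by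
  refine ⟨0, Submodule.zero_mem _, ?_⟩
  intro P
  have hP : ∀ β, P β = 0 := fun β ↦ by
    simp only [P, map_zero]
  refine ⟨fun β _ ↦ ?_, fun β ↦ ?_, hP 0⟩
  · rw [hP]
    exact IsRationalClass.zero
  · rw [hP]
    exact IsOfHodgeType.zero A _ _ _

/-- **The theta span kills the theta-orthogonal kernel** (`dim X = 2n`, `n = m + 1`), CONDITIONAL on
`Grothendieck1969_supportedClasses_le_hodgeConiveau` and `hodgeClasses_cupPairing_nondegenerate (2n) X`. If
every rational Hodge `(n,n)`-class lies in the theta span `M(D) = SCⁿ(D) ⊔ SC^m(D) · N¹ ⊔ Hdg^{m,m}_ℚ · N¹`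
(the conclusion of `MiddleThetaSpan` at `D`), then a rational Hodge `(n,n)`-class `e` cup-orthogonal to the
theta world `TW(D) = SCⁿ(D) ⊔ SCon(D) ⊔ Hdg^{m,m}_ℚ · N¹` (the three summands of `OrthogonalSplit`) is zero:
`M(D) ≤ ker (e ∪ ·)` — summands 1 and 3 of `M(D)` are summands of `TW(D)`, summand 2 lies in summand 3
(`spanCup_sc_le_spanCup_ratHodge`; rational special classes of codimension `m` are supported in
codimension `≥ m`, hence of type `(m,m)` by the coniveau inclusion) — so `e` is cup-orthogonal to every
rational Hodge `(n,n)`-class, and the perfect pairing on Hodge classes ("there exists `α ∈ Hdg^{2n}(X)`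
such that `0 ≠ α ∪ ζ`") leaves `e = 0`. [cite: BrosnanFangNiePearlstein2009, §6 (6.1) and proof of Lemma 50]
[cite: GrothendieckTopology1969, p. 299 (∗) and p. 300] -/
theorem eq_zero_of_thetaSpan_of_cup_orthogonal
    (hG : Grothendieck1969_supportedClasses_le_hodgeConiveau)
    (hP : hodgeClasses_cupPairing_nondegenerate (2 * (m + 1)) X)
    (D : UnitaryBallQuotientDatum (2 * (m + 1)) X)
    (hspan : ∀ c : complexBetti X (2 * (m + 1)), IsRationalClass c →
      IsOfHodgeType (2 * (m + 1)) X (2 * (m + 1)) (m + 1) (m + 1) c →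
      c ∈ specialCycleClasses D (m + 1) ⊔
        Submodule.span ℂ {z : complexBetti X (2 * (m + 1)) |
          ∃ s ∈ specialCycleClasses D m, ∃ d ∈ algebraicClasses X 1,
            z = cupProduct (two_mul_add_two_mul m 1) s d} ⊔
        Submodule.span ℂ {z : complexBetti X (2 * (m + 1)) |
          ∃ a : complexBetti X (2 * m), IsRationalClass a ∧
            IsOfHodgeType (2 * (m + 1)) X (2 * m) m m a ∧
              ∃ d ∈ algebraicClasses X 1, z = cupProduct (two_mul_add_two_mul m 1) a d})
    {e : complexBetti X (2 * (m + 1))} (heQ : IsRationalClass e)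
    (heH : IsOfHodgeType (2 * (m + 1)) X (2 * (m + 1)) (m + 1) (m + 1) e)
    (horth : ∀ x ∈ (specialCycleClasses D (m + 1) ⊔
      (⨆ (W : Submodule D.E (Fin (2 * (m + 1) + 1) → D.E))
        (_ : IsTotallyPositive (conjRingHom D.E) D.H W) (_ : Module.finrank D.E W = m) (Z : Set X.left)
        (_ : IsClosed Z) (_ : Z ⊆ D.specialSubvariety W)
        (_ : ∀ z ∈ Z, ((m + 1 : ℕ) : ℕ∞) ≤ Order.coheight z), classesSupportedOn X Z (2 * (m + 1))) ⊔
      Submodule.span ℂ {z : complexBetti X (2 * (m + 1)) |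
        ∃ a : complexBetti X (2 * m), IsRationalClass a ∧
          IsOfHodgeType (2 * (m + 1)) X (2 * m) m m a ∧
            ∃ d ∈ algebraicClasses X 1, z = cupProduct (two_mul_add_two_mul m 1) a d}),
      cupProduct (two_mul_add_two_mul (m + 1) (m + 1)) e x = 0) :
    e = 0 := by
  have hX : IsSmoothProjective (2 * (m + 1)) X := D.isSmoothProjective
  obtain ⟨A, heA⟩ := heH
  -- rational special cycle classes of codimension `m` are of type `(m,m)` (coniveau inclusion)
  have hdiag : ∀ c ∈ specialCycleClasses D m, IsRationalClass c →
      IsOfHodgeType (2 * (m + 1)) X (2 * m) m m c := fun c hc _ ↦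
    ⟨A, pullback_mem_hodgePQ_of_mem_supportedClasses hG hX A
      (specialCycleClasses_le_supportedClasses D m hc)⟩
  -- the kernel of `e ∪ ·` contains the theta span
  set K : Submodule ℂ (complexBetti X (2 * (m + 1))) :=
    LinearMap.ker (cupProduct (two_mul_add_two_mul (m + 1) (m + 1)) e) with hK
  have hmemK : ∀ x, x ∈ K ↔ cupProduct (two_mul_add_two_mul (m + 1) (m + 1)) e x = 0 :=
    fun x ↦ LinearMap.mem_ker
  have hMK : specialCycleClasses D (m + 1) ⊔
      Submodule.span ℂ {z : complexBetti X (2 * (m + 1)) |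
        ∃ s ∈ specialCycleClasses D m, ∃ d ∈ algebraicClasses X 1,
          z = cupProduct (two_mul_add_two_mul m 1) s d} ⊔
      Submodule.span ℂ {z : complexBetti X (2 * (m + 1)) |
        ∃ a : complexBetti X (2 * m), IsRationalClass a ∧
          IsOfHodgeType (2 * (m + 1)) X (2 * m) m m a ∧
            ∃ d ∈ algebraicClasses X 1, z = cupProduct (two_mul_add_two_mul m 1) a d} ≤ K := by
    refine sup_le (sup_le ?_ ?_) ?_
    · -- summand 1 `SCⁿ(D)` is summand 1 of the theta world
      intro x hx
      exact (hmemK x).2 (horth x (Submodule.mem_sup_left (Submodule.mem_sup_left hx)))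
    · -- summand 2 `SC^m · N¹` lies in summand 3
      refine (spanCup_sc_le_spanCup_ratHodge m D hdiag).trans ?_
      intro x hx
      exact (hmemK x).2 (horth x (Submodule.mem_sup_right hx))
    · -- summand 3 `Hdg^{m,m}_ℚ · N¹` is summand 3 of the theta world
      intro x hx
      exact (hmemK x).2 (horth x (Submodule.mem_sup_right hx))
  -- `e` is cup-orthogonal to every rational Hodge `(n,n)`-class: the perfect pairing leaves `e = 0`
  by_contra he0
  obtain ⟨a, haQ, haH, hne⟩ := hP hX (2 * ((m + 1) + (m + 1))) (by omega)
    (two_mul_add_two_mul (m + 1) (m + 1)) e heQ ⟨A, heA⟩ he0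
  exact hne ((hmemK a).1 (hMK (hspan a haQ haH)))

/-- **`EnvelopedOfThetaSpan` from the perfect pairing on Hodge classes** (route `EndoscopicMiddleDegree`,
item stmt-HodgeConjecture-14732), CONDITIONAL on the Literature named facts
`Grothendieck1969_supportedClasses_le_hodgeConiveau` and `hodgeClasses_cupPairing_nondegenerate`: under
`MiddleThetaSpan` a rational Hodge `(n,n)`-class cup-orthogonal to the theta world vanishes
(`eq_zero_of_thetaSpan_of_cup_orthogonal`), and the zero class is enveloped by the zero correspondence
(`orthogonalEnveloped_zero`) — the theta-orthogonal kernel `E(D)` is zero and the envelope is vacuous.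
[cite: BrosnanFangNiePearlstein2009, §6 (6.1) and proof of Lemma 50]
[cite: GrothendieckTopology1969, p. 299 (∗) and p. 300] -/
theorem envelopedOfThetaSpan_of_cupPairing
    (hG : Grothendieck1969_supportedClasses_le_hodgeConiveau)
    (hP : ∀ (d : ℕ) (Y : SchemeOver ℂ), hodgeClasses_cupPairing_nondegenerate d Y) :
    Theses.EndoscopicMiddleDegree.EnvelopedOfThetaSpan := by
  unfold Theses.EndoscopicMiddleDegree.EnvelopedOfThetaSpan
    Theses.EndoscopicMiddleDegree.OrthogonalEnveloped
  intro hspan μ _ m X D hm1 hm2 e heQ heH horth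
  obtain ⟨A, heA⟩ := id heH
  obtain rfl : e = 0 := eq_zero_of_thetaSpan_of_cup_orthogonal hG (hP _ X) D (hspan m X D hm1 hm2)
    heQ heH horth
  exact orthogonalEnveloped_zero μ D A

/-- **`EnvelopedOfThetaSpan` from the Kähler package** — the same, with the perfect pairing (6.1) supplied
by hard Lefschetz + Hodge–Riemann for the hyperplane class (`hardLefschetz_hodgeRiemann`, the residue of
`orthogonalSplit_of_kaehlerPackage`; (6.1) follows by
`hodgeClasses_cupPairing_nondegenerate_of_hardLefschetz_hodgeRiemann` and the tree theorem
`hodgePQ_independent_of_hodgeModel_holds`), so that this item adds nothing to the route's trust base.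
[cite: VoisinHodgeI2002, Thm. 6.25, Thm. 6.32 and §7.1.2] [cite: BrosnanFangNiePearlstein2009, §6 (6.1)] -/
theorem envelopedOfThetaSpan_of_kaehlerPackage
    (hG : Grothendieck1969_supportedClasses_le_hodgeConiveau)
    (hK : ∀ (n : ℕ) (Y : SchemeOver ℂ), hardLefschetz_hodgeRiemann n Y) :
    Theses.EndoscopicMiddleDegree.EnvelopedOfThetaSpan :=
  envelopedOfThetaSpan_of_cupPairing hG
    (hodgeClasses_cupPairing_nondegenerate_of_hardLefschetz_hodgeRiemann
      hodgePQ_independent_of_hodgeModel_holds fun d Y hY ↦ hK d Y hY)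

end Summit.HodgeConjecture.HodgeConjecture.Theorems

end
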